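import Mathlib
import Summits.AtomisticToContinuum.Crystallization.Theorems.NashClassCertificatesNashNearFieldBondStiffnessTube40

/-!
# Crux `NashNearField` (stmt-AtomisticToContinuum-16827), line `birth`: second-shell stiffness bounds for the tube-coercivity input of
# `stub_nashFlatnessPaid` (I_flat)

Companion of `…BondStiffnessTube40` (first shell, `r ∈ [19/20, 21/20]`).  Second-shell bonds of the `1/40` tube have lengths in
`[5/4, 3/2] ⊇ √2·[47/50, 1]·[0.95, 1.05]`, where the pair potential is CONCAVE (`V″ < 0` beyond the inflection `r⁶ = 13/7`) but only mildly,
and attractive (`V′ > 0`).  Explicit constants (exact rational arithmetic; the wide interval is handled by the substitution `y = r⁶`,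
`r¹⁴ = r²y² ≥ (25/16)y²`, and a positive-definite quadratic in `y`):

* `lj_deriv2_ge_on_shell2` — `−2/3 ≤ V″(r)` for `5/4 ≤ r ≤ 3/2` (true minimum `V″(5/4) ≈ −0.60`);
* `lj_deriv2_le_on_shell2` — `V″(r) ≤ 0` there;
* `lj_deriv_div_ge_on_shell2` / `lj_deriv_div_le_on_shell2` — `0 ≤ V′(r)/r ≤ 2/15` there (true maximum `≈ 0.124`);
* `Hess₀_ge_on_shell2` — hence `Hess₀ e w ≥ −(2/3)·(⟪e,w⟫/‖e‖)² ≥ −(2/3)‖w‖²`: a second-shell bond softens the frozen-exterior Hessian by at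
  most `2/3` per unit squared LONGITUDINAL relative displacement and never through its transverse part.
All `[folklore]`; `--as helper` pieces for the line's energy stub (constants of the proposed shared item TC@1/40).
-/

noncomputable section

open Literature.MathematicalPhysics.StatisticalMechanics

namespace Summit.AtomisticToContinuum.Crystallization.Theorems.NashClassCertificatesNashNearField

open Summit.AtomisticToContinuum.Crystallization.Theorems.PhononStabilityNegative

/-- `−2/3 ≤ V″(r)` on `[5/4, 3/2]`. [folklore] -/
theorem lj_deriv2_ge_on_shell2 {r : ℝ} (h1 : 5 / 4 ≤ r) (h2 : r ≤ 3 / 2) :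
    -(2 / 3) ≤ deriv (deriv lennardJones) r := by
  have hr : 0 < r := by linarith
  have _h := h2
  rw [deriv_deriv_lennardJones hr.ne']
  -- `13 − 7y + (2/3) r¹⁴ ≥ 13 − 7y + (25/24) y² > 0`, `y = r⁶`, `r¹⁴ = r² y² ≥ (25/16) y²`
  have hr2 : (25 / 16 : ℝ) ≤ r ^ 2 := by nlinarith
  have h14 : (25 / 16 : ℝ) * (r ^ 6) ^ 2 ≤ r ^ 14 := by
    have : r ^ 14 = r ^ 2 * (r ^ 6) ^ 2 := by ring
    rw [this]
    exact mul_le_mul_of_nonneg_right hr2 (by positivity)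
  have hquad : 0 ≤ 13 - 7 * r ^ 6 + (25 / 24 : ℝ) * (r ^ 6) ^ 2 := by
    nlinarith [sq_nonneg (r ^ 6 - 84 / 25)]
  have hkey : -(2 / 3 : ℝ) * r ^ 14 ≤ 13 - 7 * r ^ 6 := by nlinarith
  have hr14 : 0 < r ^ 14 := by positivity
  have hinv : (r⁻¹) ^ 14 = (r ^ 14)⁻¹ := by rw [inv_pow]
  have hinv8 : (r⁻¹) ^ 8 = r ^ 6 * (r ^ 14)⁻¹ := by
    rw [inv_pow]; field_simp
  rw [hinv, hinv8]
  rw [show (13 : ℝ) * (r ^ 14)⁻¹ - 7 * (r ^ 6 * (r ^ 14)⁻¹) = (13 - 7 * r ^ 6) * (r ^ 14)⁻¹ by ring]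
  rw [le_mul_inv_iff₀ hr14]
  linarith

/-- `V″(r) ≤ 0` on `[5/4, 3/2]` (indeed for `r⁶ ≥ 13/7`). [folklore] -/
theorem lj_deriv2_le_on_shell2 {r : ℝ} (h1 : 5 / 4 ≤ r) (h2 : r ≤ 3 / 2) :
    deriv (deriv lennardJones) r ≤ 0 := by
  have hr : 0 < r := by linarith
  have _h := h2
  rw [deriv_deriv_lennardJones hr.ne']
  have h6 : (5 / 4 : ℝ) ^ 6 ≤ r ^ 6 := pow_le_pow_left₀ (by norm_num) h1 6
  have hkey : 13 - 7 * r ^ 6 ≤ 0 := by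
    have hc : (13 : ℝ) ≤ 7 * (5 / 4 : ℝ) ^ 6 := by norm_num
    linarith
  have hr14 : 0 < r ^ 14 := by positivity
  have hinv : (r⁻¹) ^ 14 = (r ^ 14)⁻¹ := by rw [inv_pow]
  have hinv8 : (r⁻¹) ^ 8 = r ^ 6 * (r ^ 14)⁻¹ := by
    rw [inv_pow]; field_simp
  rw [hinv, hinv8]
  rw [show (13 : ℝ) * (r ^ 14)⁻¹ - 7 * (r ^ 6 * (r ^ 14)⁻¹) = (13 - 7 * r ^ 6) * (r ^ 14)⁻¹ by ring]
  exact mul_nonpos_of_nonpos_of_nonneg hkey (by positivity)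

/-- `0 ≤ V′(r)/r` on `[5/4, 3/2]` (attractive regime). [folklore] -/
theorem lj_deriv_div_ge_on_shell2 {r : ℝ} (h1 : 5 / 4 ≤ r) (h2 : r ≤ 3 / 2) :
    0 ≤ deriv lennardJones r / r := by
  have hr : 0 < r := by linarith
  have _h := h2
  rw [deriv_lennardJones hr.ne']
  have heq : (-(r⁻¹) ^ 13 + (r⁻¹) ^ 7) / r = (r ^ 6 - 1) * (r ^ 14)⁻¹ := by
    rw [inv_pow, inv_pow]; field_simp; ring
  rw [heq]
  have h6 : (1 : ℝ) ≤ r ^ 6 := one_le_pow₀ (by linarith)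
  exact mul_nonneg (by linarith) (by positivity)

/-- `V′(r)/r ≤ 2/15` on `[5/4, 3/2]` (true maximum `≈ 0.124`). [folklore] -/
theorem lj_deriv_div_le_on_shell2 {r : ℝ} (h1 : 5 / 4 ≤ r) (h2 : r ≤ 3 / 2) :
    deriv lennardJones r / r ≤ 2 / 15 := by
  have hr : 0 < r := by linarith
  have _h := h2
  rw [deriv_lennardJones hr.ne']
  have hr14 : 0 < r ^ 14 := by positivity
  have heq : (-(r⁻¹) ^ 13 + (r⁻¹) ^ 7) / r = (r ^ 6 - 1) * (r ^ 14)⁻¹ := by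
    rw [inv_pow, inv_pow]; field_simp; ring
  rw [heq, mul_inv_le_iff₀ hr14]
  -- `y − 1 ≤ (2/15) r¹⁴`, with `(2/15) r¹⁴ ≥ (5/24) y²` and `(5/24)y² − y + 1 ≥ 0` for `y ≥ (5/4)⁶`
  have hr2 : (25 / 16 : ℝ) ≤ r ^ 2 := by nlinarith
  have h14 : (25 / 16 : ℝ) * (r ^ 6) ^ 2 ≤ r ^ 14 := by
    have : r ^ 14 = r ^ 2 * (r ^ 6) ^ 2 := by ring
    rw [this]
    exact mul_le_mul_of_nonneg_right hr2 (by positivity)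
  have h6 : (5 / 4 : ℝ) ^ 6 ≤ r ^ 6 := pow_le_pow_left₀ (by norm_num) h1 6
  have hy : (7 / 2 : ℝ) ≤ r ^ 6 := by
    have hc : (7 / 2 : ℝ) ≤ (5 / 4 : ℝ) ^ 6 := by norm_num
    linarith
  have hquad : r ^ 6 - 1 ≤ (5 / 24 : ℝ) * (r ^ 6) ^ 2 := by nlinarith
  nlinarith

/-- **Second-shell bonds soften by at most `2/3` per unit squared longitudinal displacement, never transversally**: for
`‖e‖ ∈ [5/4, 3/2]`, `Hess₀ e w ≥ −(2/3)·(⟪e, w⟫/‖e‖)²`. [folklore] -/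
theorem Hess₀_ge_on_shell2 {e : EuclideanSpace ℝ (Fin 3)} (w : EuclideanSpace ℝ (Fin 3)) (h1 : 5 / 4 ≤ ‖e‖) (h2 : ‖e‖ ≤ 3 / 2) :
    -(2 / 3) * (inner ℝ e w / ‖e‖) ^ 2 ≤ Hess₀ e w := by
  unfold Hess₀
  set c := inner ℝ e w / ‖e‖ with hc
  have hpos : 0 < ‖e‖ := by linarith
  have hc2 : c ^ 2 ≤ ‖w‖ ^ 2 := by
    have hcs : |inner ℝ e w| ≤ ‖e‖ * ‖w‖ := abs_real_inner_le_norm e w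
    have : |c| ≤ ‖w‖ := by
      rw [hc, abs_div, abs_of_pos hpos, div_le_iff₀ hpos]; linarith [mul_comm ‖e‖ ‖w‖]
    nlinarith [abs_nonneg c, sq_abs c]
  have hA := lj_deriv2_ge_on_shell2 h1 h2
  have hB := lj_deriv_div_ge_on_shell2 h1 h2
  have ht : 0 ≤ ‖w‖ ^ 2 - c ^ 2 := sub_nonneg.2 hc2
  nlinarith [mul_le_mul_of_nonneg_right hA (sq_nonneg c), mul_nonneg hB ht]

/-- The same with the cruder right-hand side `−(2/3)‖w‖²`. [folklore] -/
theorem Hess₀_ge_neg_on_shell2 {e : EuclideanSpace ℝ (Fin 3)} (w : EuclideanSpace ℝ (Fin 3)) (h1 : 5 / 4 ≤ ‖e‖) (h2 : ‖e‖ ≤ 3 / 2) :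
    -(2 / 3) * ‖w‖ ^ 2 ≤ Hess₀ e w := by
  have h := Hess₀_ge_on_shell2 w h1 h2
  have hpos : 0 < ‖e‖ := by linarith
  have hc2 : (inner ℝ e w / ‖e‖) ^ 2 ≤ ‖w‖ ^ 2 := by
    have hcs : |inner ℝ e w| ≤ ‖e‖ * ‖w‖ := abs_real_inner_le_norm e w
    have : |inner ℝ e w / ‖e‖| ≤ ‖w‖ := by
      rw [abs_div, abs_of_pos hpos, div_le_iff₀ hpos]; linarith [mul_comm ‖e‖ ‖w‖]
    nlinarith [abs_nonneg (inner ℝ e w / ‖e‖), sq_abs (inner ℝ e w / ‖e‖)]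
  nlinarith

end Summit.AtomisticToContinuum.Crystallization.Theorems.NashClassCertificatesNashNearField

end
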